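import Summits.SmoothPoincare4.SmoothPoincare4.Theses.CommonDualRelay
import Literature.Topology.FourManifolds.HCobordismHandlesProofs
import Literature.Topology.FourManifolds.HomotopyS4CompactProofs
import Literature.Topology.FourManifolds.SphereSimplyConnected

/-!
# Crux `DualPresentation` (stmt-SmoothPoincare4-15791) — split piece `SpherePresentation`
# (stmt-SmoothPoincare4-18144 = ThreePointSpheres' stmt-11167): birth skeleton `split-presentation`

Line: Smale's transferable steps.  Two registered stubs and the kernel-checked composition
`SpherePresentation_of : SpherePresentation` — proved from the two stubs used BY NAME (the only `sorry`s) —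
whose glue is the PROVED part of the chain: compactness of a homotopy 4-sphere
(`compactSpace_of_homotopyEquiv_sphere_four_holds`), simple connectivity of `S⁴` and its transport
(`simplyConnectedSpace_sphere_four_holds`, `simplyConnectedSpace_of_homotopyEquiv_sphere_four`), and
two-three handle trading in the 5-dimensional h-cobordism
(`exists_isMorseFunction_two_three_of_isHCobordism_holds`, Milnor Thm 8.1 + 4.8, PROVED in the tree).

* `stub_thetaFour_bare` (Kervaire–Milnor 1963, `Θ₄ = 0` as h-cobordism classes; the tree's named fact
  `isHCobordant_sphere_of_homotopySphere_four` in bare-binder form and the `S⁴ → M` direction): every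
  compact smooth `M ≃ₕ S⁴` is smoothly h-cobordant FROM `S⁴`.
* `stub_middleLevel_fromSphere` (the middle-level fact (B) `exists_dualSpheres_middleLevel_of_two_three`
  specialised to h-cobordisms from `S⁴`, level-embedding clause dropped): a two-three Morse function on
  an h-cobordism `S⁴ ~ M` yields the algebraically dual middle-level presentation.
-/

set_option linter.dupNamespace false

namespace Summit.SmoothPoincare4.SmoothPoincare4.Cruxes.DualPresentation.SplitPresentation

open scoped Manifold ContDiff Topology ContinuousMap
open Literature.Topology.FourManifolds
open Summit.SmoothPoincare4.SmoothPoincare4.Theses.CommonDualRelay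

/-- Local notation: the standard spheres. -/
local notation "𝕊⁴" => (Metric.sphere (0 : EuclideanSpace ℝ (Fin 5)) 1)
local notation "𝕊²" => (Metric.sphere (0 : EuclideanSpace ℝ (Fin 3)) 1)

/-- STUB (`Θ₄ = 0`, Kervaire–Milnor 1963 table p. 504 via Thm 5.1, §4 and Lemma 2.3; bare-binder form of
the tree's named fact `isHCobordant_sphere_of_homotopySphere_four`, direction `S⁴ → M` by
`IsHCobordant.symm`): every compact smooth 4-manifold homotopy equivalent to `S⁴` is smoothly
h-cobordant from the standard `S⁴`. -/
theorem stub_thetaFour_bare :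
    ∀ (M : Type) [TopologicalSpace M] [T2Space M] [SecondCountableTopology M]
      [ChartedSpace (EuclideanSpace ℝ (Fin 4)) M] [IsManifold (𝓡 4) ∞ M] [CompactSpace M],
      M ≃ₕ 𝕊⁴ → IsHCobordant 4 𝕊⁴ M := by
  sorry

/-- STUB (the middle level of a two-three handlebody of an h-cobordism FROM `S⁴`; the tree's named fact
(B) `exists_dualSpheres_middleLevel_of_two_three` with `X₁ = S⁴`, `X₂ = M`, level-embedding clause
dropped; Kirby 1996 §2, Matveyev 1996 Proof of Theorem, Milnor 1965 Thm 3.13 / §3 p. 21 / Thm 7.6). -/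
theorem stub_middleLevel_fromSphere :
    ∀ (M : Type) [TopologicalSpace M] [T2Space M] [SecondCountableTopology M]
      [ChartedSpace (EuclideanSpace ℝ (Fin 4)) M] [IsManifold (𝓡 4) ∞ M] [CompactSpace M]
      [SimplyConnectedSpace M] (c : Cobordism 4 𝕊⁴ M) (f : c.W → ℝ), c.IsHCobordism →
      c.IsMorseFunction f →
      (∀ z, IsMCriticalPt (𝓡∂ (4 + 1)) f z →
        morseIndex (𝓡∂ (4 + 1)) f z = 2 ∧ f z < 2⁻¹ ∨ morseIndex (𝓡∂ (4 + 1)) f z = 3 ∧ 2⁻¹ < f z) →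
      ∃ (N : Type) (_ : TopologicalSpace N) (_ : T2Space N) (_ : SecondCountableTopology N)
        (_ : ChartedSpace (EuclideanSpace ℝ (Fin 4)) N) (_ : IsManifold (𝓡 4) ∞ N) (_ : CompactSpace N)
        (_ : SimplyConnectedSpace N) (oN : SmoothOrientation (𝓡 4) N)
        (oS oP : SmoothOrientation (𝓡 2) 𝕊²) (k : ℕ) (S P : FramedSphereFamily (𝓡 4) N (Fin k) 2 2),
        IsAlgebraicallyDual (𝓡 2) (𝓡 2) (𝓡 4) two_add_two_eq_four oS oP oN S.sphere P.sphere ∧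
        P.IsSurgery (𝓡 4) 𝕊⁴ ∧ S.IsSurgery (𝓡 4) M := by
  sorry

/-- COMPOSITION (kernel-checked; the only `sorry`s are inside the two declared stubs, used here BY NAME): package `M` (compact by Hatcher 3.29, simply connected by
transport from `S⁴` — both PROVED tree theorems), take the h-cobordism from `S⁴` (stub 1), trade
handles to a two-three handlebody (PROVED: `exists_isMorseFunction_two_three_of_isHCobordism_holds`),
and read off the middle level (stub 2). -/
theorem SpherePresentation_of :
    Summit.SmoothPoincare4.SmoothPoincare4.Theses.CommonDualRelay.SpherePresentation := by
  intro M _ _ _ _ _ e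
  haveI : CompactSpace M := compactSpace_of_homotopyEquiv_sphere_four_holds M e
  haveI : SimplyConnectedSpace 𝕊⁴ := simplyConnectedSpace_sphere_four_holds
  haveI : SimplyConnectedSpace M :=
    simplyConnectedSpace_of_homotopyEquiv_sphere_four simplyConnectedSpace_sphere_four_holds M e
  obtain ⟨c, hc⟩ := stub_thetaFour_bare M e
  obtain ⟨f, hf, h23, -⟩ := exists_isMorseFunction_two_three_of_isHCobordism_holds 𝕊⁴ M c hc
  exact stub_middleLevel_fromSphere M c f hc hf h23

end Summit.SmoothPoincare4.SmoothPoincare4.Cruxes.DualPresentation.SplitPresentation
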